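import Mathlib
import HarnessLib
import Summits.HubbardSuperconductivity.HubbardSuperconductivity.Theorems.KLProgrammeKLRegimeFlowReadPrivStep

/-!
# Route `KLProgramme`, crux K3 — gen-8 ENGINE-FLOW child (stmt-HubbardSuperconductivity-20437 `KLRegimeEngineV17F2`), stub (C)
# `stub_twoLeg_curvature`, v2 text: «(P)-LAST» — the LAST step of the closer's private two-conjunct induction in ABSTRACT
# increment currency (located item #20 «(C)-B-LAST-SIZE», ruling (R111): choice (δ) «(C)-LAST-THERMAL»)

Seat hubbard-kl-k3c3-p1 (g12; row «δμ-flow with klAngularMean constant piece»).  Companion of «(P)-STEP» (`twoLegReadPriv_flow_succ`,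
…FlowReadPrivStep): there the step `n → n+1` is fed by (A) + the three residue doors (B)/(C2)/(C1).  Ruling (R111) runs that step only for
`m + 1 ≤ n_β` and closes the LAST index by a direct bound of the last slice's reading increment (p2 lineage, «(C)-LAST-THERMAL»).  This file is
the RECEIVING END of that bound, signature-independent: for ANY two frames `K, K′` and any scale `n`,

* the private induction hypothesis at `(K, n)`: `TwoLegReadJetBound L M cc cc′ β U μ K n ∧ TwoLegReadOscAt L M x₀ β U μ K n`;
* the TOTAL increment `Δ := θ ↦ ν_{n+1}(K′)(θ) − ν_n(K)(θ)` (each reading on its own frame's curve): `C⁴`, jets `k ≤ 4` within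
  `curveJetBar eΔ eΔ′ U k (n+1)`, and its mean-free value within `xΔ·U²·4^{−2(n+1)}` (or STRUCTURED: within `aΔ·U²·4^{−2(n+1)}` of a constant);
* fits `4^{2−k}·cc k + eΔ k ≤ C k`, `4^{2−k}·cc′ k + eΔ′ k ≤ C′ k` (`k ≤ 4`) and `16·x₀ + xΔ ≤ X`

⟹ both conjuncts at `(K′, n+1)` at the tables `(C, C′, X)`.  The factors `4^{2−k}` / `16` are the INDEX SHIFT of the bars (`curveJetBar c c′ U k n =
curveJetBar (4^{2−k}c) (4^{2−k}c′) U k (n+1)`, `4^{−2n} = 16·4^{−2(n+1)}`): the value/slope rows of the cumulative reading do not decay by themselves,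
so the inherited private tables pay `16×` / `4×` at `k = 0, 1` and gain `4×` / `16×` at `k = 3, 4` — harmless at natural-size private tables against the
registered `(2¹⁰, 2¹⁰, 2⁴, 2⁴, 2¹¹)`.

* §1 index-shift algebra; `TwoLegReadJetBound.mono_le` (fits asked for `k ≤ 4` only); mean-free value is subadditive.
* §2 `twoLegReadJetBound_last_of_increment` (jets), `twoLegReadOscAt_last_of_increment` (mean-free value), **`twoLegReadPriv_last`** (both, with fits),
  `twoLegReadPriv_last_of_structured` (Osc of `Δ` from a structured value).
* §3 SPLIT increment `Δ = δ_{n+1}(K′) + S`, `S := θ ↦ ν_n(K′)(θ) − ν_n(K)(θ)` (the frame shift of the scale-`n` cumulative reading): (A) at `(K′, n+1)`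
  in c4a-1's currency `TwoLegCurveJetBound` + jets / structured value of `S` ⟹ the same conclusion (`twoLegReadPriv_last_of_split`).
* §4 the flow/registered instance at `(K_n, K_{n+1}) = (klFlowFrameU … n, klFlowFrameU … (n+1))` and the tables `(klC4aJetC2, klC4aJetC′ P R, klReadOscC P R)`
  with UNROLLED numeric fits (`16·cc 0 + eΔ 0 ≤ 2¹⁰`, `4·cc 1 + eΔ 1 ≤ 2¹⁰`, `cc 2 + eΔ 2 ≤ 2⁴`, `cc 3/4 + eΔ 3 ≤ 2⁴`, `cc 4/16 + eΔ 4 ≤ 2¹¹`, primed alike,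
  `16·x₀ + xΔ ≤ klReadOscC P R`): `twoLegRead_flow_last_registered`.

If the cure of #20 instead bounds the (P) residue at `m = n_β` by a new door ((R111)(3) fallback (γ)), «(P)-STEP» receives it unchanged (its `hB` is an
abstract bound of the frame-response bracket; only `eB 0 = 0` is asked).  Bookkeeping only; no definition; nothing here asserts any stub of 20437, K3 or
superconductivity.  References: BGM 2006 §2.4 (2.36)–(2.42) [cite: BenfattoGiulianiMastropietro2006].
-/

noncomputable section

namespace Summit.HubbardSuperconductivity.HubbardSuperconductivity.Theorems.KLRegimeSplit

set_option linter.dupNamespace false -- summit = problem name (single-conjunct summit), D-0017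

open Real Literature.MathematicalPhysics.QuantumLattice Literature.Probability.LatticeModels
open Literature.MathematicalPhysics.QuantumLattice.FermiRG

/-! ## §1 Index-shift algebra, table monotonicity at `k ≤ 4`, subadditivity of the mean-free value -/

/-- `4^{(k−2)·n} = 4^{2−k} · 4^{(k−2)(n+1)}`. -/
theorem four_zpow_index_succ (k n : ℕ) :
    (4 : ℝ) ^ (((k : ℤ) - 2) * (n : ℕ)) = (4 : ℝ) ^ ((2 : ℤ) - k) * (4 : ℝ) ^ (((k : ℤ) - 2) * ((n + 1 : ℕ) : ℤ)) := by
  rw [← zpow_add₀ (by norm_num : (4 : ℝ) ≠ 0)]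
  congr 1
  push_cast
  ring

/-- `4^{−2n} = 16 · 4^{−2(n+1)}` (the mean-free value law one index on). -/
theorem four_zpow_neg_two_index_succ (n : ℕ) :
    (4 : ℝ) ^ (-2 * (n : ℤ)) = 16 * (4 : ℝ) ^ (-2 * ((n + 1 : ℕ) : ℤ)) := by
  rw [show (-2 * ((n + 1 : ℕ) : ℤ)) = -2 * (n : ℤ) + (-2) by push_cast; ring, zpow_add₀ (by norm_num : (4 : ℝ) ≠ 0)]
  rw [show ((4 : ℝ) ^ (-2 : ℤ)) = 16⁻¹ by norm_num]
  ring

/-- **Index shift of the bar**: `curveJetBar c c′ U k n = curveJetBar (4^{2−k}·c) (4^{2−k}·c′) U k (n+1)`. -/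
theorem curveJetBar_index_succ (c c' : ℕ → ℝ) (U : ℝ) (k n : ℕ) :
    curveJetBar c c' U k n =
      curveJetBar (fun k => (4 : ℝ) ^ ((2 : ℤ) - k) * c k) (fun k => (4 : ℝ) ^ ((2 : ℤ) - k) * c' k) U k (n + 1) := by
  simp only [curveJetBar]
  rw [four_zpow_index_succ k n]
  ring

/-- The index-shift factors at `k = 0 … 4`: `16, 4, 1, 1/4, 1/16`. -/
theorem four_zpow_two_sub_values :
    (4 : ℝ) ^ ((2 : ℤ) - (0 : ℕ)) = 16 ∧ (4 : ℝ) ^ ((2 : ℤ) - (1 : ℕ)) = 4 ∧ (4 : ℝ) ^ ((2 : ℤ) - (2 : ℕ)) = 1 ∧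
      (4 : ℝ) ^ ((2 : ℤ) - (3 : ℕ)) = 4⁻¹ ∧ (4 : ℝ) ^ ((2 : ℤ) - (4 : ℕ)) = 16⁻¹ := by
  norm_num

section Model

variable {L M : ℕ} [NeZero L] [NeZero M]

/-- **Monotonicity in the tables asked at `k ≤ 4` only** (the predicate never reads `k ≥ 5`). -/
theorem TwoLegReadJetBound.mono_le {c c' d d' : ℕ → ℝ} {β U μ : ℝ} {K : TrigPolyC4v} {n : ℕ}
    (hcd : ∀ k ≤ 4, c k ≤ d k) (hcd' : ∀ k ≤ 4, c' k ≤ d' k) (h : TwoLegReadJetBound L M c c' β U μ K n) :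
    TwoLegReadJetBound L M d d' β U μ K n := by
  refine ⟨h.1, fun k hk θ => (h.2 k hk θ).trans ?_⟩
  unfold curveJetBar
  have hU := abs_nonneg U
  have h1 := hcd k hk
  have h2 := hcd' k hk
  refine mul_le_mul_of_nonneg_right (mul_le_mul_of_nonneg_right ?_ (uPow_nonneg k U)) (zpow_nonneg (by norm_num) _)
  nlinarith

end Model

/-- **The mean-free value is subadditive**: `|(f+g)(θ) − mean(f+g)| ≤ |f(θ) − mean f| + |g(θ) − mean g|` (interval-integrable profiles). -/
theorem abs_add_sub_klAngularMean_le {f g : ℝ → ℝ} (hf : IntervalIntegrable f MeasureTheory.volume 0 (2 * π))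
    (hg : IntervalIntegrable g MeasureTheory.volume 0 (2 * π)) (θ : ℝ) :
    |(f θ + g θ) - klAngularMean (fun θ => f θ + g θ)| ≤ |f θ - klAngularMean f| + |g θ - klAngularMean g| := by
  rw [klAngularMean_add hf hg]
  calc |(f θ + g θ) - (klAngularMean f + klAngularMean g)| = |(f θ - klAngularMean f) + (g θ - klAngularMean g)| := by ring_nf
    _ ≤ |f θ - klAngularMean f| + |g θ - klAngularMean g| := abs_add_le _ _

/-! ## §2 The last step from the TOTAL increment `Δ = ν_{n+1}(K′) − ν_n(K)` -/

section Model

variable {L M : ℕ} [NeZero L] [NeZero M]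

/-- `ν_{n+1}(K′) = ν_n(K) + Δ` as functions of the angle. -/
theorem klLocalPart_succ_eq_prev_add_increment (β U μ : ℝ) (K K' : TrigPolyC4v) (n : ℕ) :
    (fun θ : ℝ => klLocalPart L M β U μ K' (n + 1) θ) =
      (fun θ : ℝ => klLocalPart L M β U μ K n θ) + fun θ : ℝ =>
        klLocalPart L M β U μ K' (n + 1) θ - klLocalPart L M β U μ K n θ := by
  funext θ
  simp

/-- **JETS at `(K′, n+1)` from the private jets at `(K, n)` + the jets of the total increment** (any frames): tables
`(4^{2−k}·cc k + eΔ k, 4^{2−k}·cc′ k + eΔ′ k)`. -/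
theorem twoLegReadJetBound_last_of_increment {β U μ : ℝ} {K K' : TrigPolyC4v} {n : ℕ} {cc cc' eD eD' : ℕ → ℝ}
    (hIH : TwoLegReadJetBound L M cc cc' β U μ K n)
    (hDdiff : ContDiff ℝ 4 fun θ : ℝ => klLocalPart L M β U μ K' (n + 1) θ - klLocalPart L M β U μ K n θ)
    (hD : ∀ k ≤ 4, ∀ θ : ℝ, |iteratedDeriv k (fun θ : ℝ =>
      klLocalPart L M β U μ K' (n + 1) θ - klLocalPart L M β U μ K n θ) θ| ≤ curveJetBar eD eD' U k (n + 1)) :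
    TwoLegReadJetBound L M (fun k => (4 : ℝ) ^ ((2 : ℤ) - k) * cc k + eD k)
      (fun k => (4 : ℝ) ^ ((2 : ℤ) - k) * cc' k + eD' k) β U μ K' (n + 1) := by
  have hsum := klLocalPart_succ_eq_prev_add_increment (L := L) (M := M) β U μ K K' n
  refine ⟨?_, fun k hk θ => ?_⟩
  · rw [hsum]; exact hIH.1.add hDdiff
  · rw [hsum, C4a.curveJetBar_add]
    have hk' : (k : WithTop ℕ∞) ≤ 4 := by exact_mod_cast hk
    rw [iteratedDeriv_add (hIH.1.contDiffAt.of_le hk') (hDdiff.contDiffAt.of_le hk')]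
    refine (abs_add_le _ _).trans (add_le_add ?_ (hD k hk θ))
    rw [← curveJetBar_index_succ]
    exact hIH.2 k hk θ

/-- **MEAN-FREE VALUE at `(K′, n+1)` from the private mean-free value at `(K, n)` + the mean-free value of the total increment** (any frames; the
angular mean is linear): constant `16·x₀ + xΔ`. -/
theorem twoLegReadOscAt_last_of_increment {β U μ : ℝ} {K K' : TrigPolyC4v} {n : ℕ} {x₀ xD : ℝ}
    (hcont : Continuous fun θ : ℝ => klLocalPart L M β U μ K n θ)
    (hcont' : Continuous fun θ : ℝ => klLocalPart L M β U μ K' (n + 1) θ)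
    (hIHosc : TwoLegReadOscAt L M x₀ β U μ K n)
    (hDosc : ∀ θ : ℝ, |(klLocalPart L M β U μ K' (n + 1) θ - klLocalPart L M β U μ K n θ) -
        klAngularMean (fun θ : ℝ => klLocalPart L M β U μ K' (n + 1) θ - klLocalPart L M β U μ K n θ)| ≤
      xD * U ^ 2 * (4 : ℝ) ^ (-2 * ((n + 1 : ℕ) : ℤ))) :
    TwoLegReadOscAt L M (16 * x₀ + xD) β U μ K' (n + 1) := by
  intro θ
  have hI : IntervalIntegrable (klLocalPart L M β U μ K n) MeasureTheory.volume 0 (2 * π) := hcont.intervalIntegrable _ _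
  have hID : IntervalIntegrable (fun θ : ℝ => klLocalPart L M β U μ K' (n + 1) θ - klLocalPart L M β U μ K n θ)
      MeasureTheory.volume 0 (2 * π) := (hcont'.sub hcont).intervalIntegrable _ _
  have hfun : (fun θ : ℝ => klLocalPart L M β U μ K n θ +
      (klLocalPart L M β U μ K' (n + 1) θ - klLocalPart L M β U μ K n θ)) = klLocalPart L M β U μ K' (n + 1) := by
    funext θ; ring
  have h := abs_add_sub_klAngularMean_le hI hID θ
  rw [hfun] at h
  have hθ : klLocalPart L M β U μ K n θ + (klLocalPart L M β U μ K' (n + 1) θ - klLocalPart L M β U μ K n θ) =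
      klLocalPart L M β U μ K' (n + 1) θ := by ring
  rw [hθ] at h
  refine h.trans ?_
  calc |klLocalPart L M β U μ K n θ - klAngularMean (klLocalPart L M β U μ K n)| +
        |(klLocalPart L M β U μ K' (n + 1) θ - klLocalPart L M β U μ K n θ) -
          klAngularMean (fun θ : ℝ => klLocalPart L M β U μ K' (n + 1) θ - klLocalPart L M β U μ K n θ)|
      ≤ x₀ * U ^ 2 * (4 : ℝ) ^ (-2 * (n : ℤ)) + xD * U ^ 2 * (4 : ℝ) ^ (-2 * ((n + 1 : ℕ) : ℤ)) :=
        add_le_add (hIHosc θ) (hDosc θ)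
    _ = (16 * x₀ + xD) * U ^ 2 * (4 : ℝ) ^ (-2 * ((n + 1 : ℕ) : ℤ)) := by
        rw [four_zpow_neg_two_index_succ n]; ring

/-- **«(P)-LAST» — the last step of the private induction from the TOTAL increment** (any frames `K, K′`, any scale `n`): IH at `(K, n)` + jets and
mean-free value of `Δ = ν_{n+1}(K′) − ν_n(K)` at index `n+1` + the fits (asked at `k ≤ 4`) ⟹ both conjuncts at `(K′, n+1)` at the tables `(C, C′, X)`. -/
theorem twoLegReadPriv_last {β U μ : ℝ} {K K' : TrigPolyC4v} {n : ℕ} {cc cc' eD eD' C C' : ℕ → ℝ} {x₀ xD X : ℝ}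
    (hIH : TwoLegReadJetBound L M cc cc' β U μ K n) (hIHosc : TwoLegReadOscAt L M x₀ β U μ K n)
    (hDdiff : ContDiff ℝ 4 fun θ : ℝ => klLocalPart L M β U μ K' (n + 1) θ - klLocalPart L M β U μ K n θ)
    (hD : ∀ k ≤ 4, ∀ θ : ℝ, |iteratedDeriv k (fun θ : ℝ =>
      klLocalPart L M β U μ K' (n + 1) θ - klLocalPart L M β U μ K n θ) θ| ≤ curveJetBar eD eD' U k (n + 1))
    (hDosc : ∀ θ : ℝ, |(klLocalPart L M β U μ K' (n + 1) θ - klLocalPart L M β U μ K n θ) -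
        klAngularMean (fun θ : ℝ => klLocalPart L M β U μ K' (n + 1) θ - klLocalPart L M β U μ K n θ)| ≤
      xD * U ^ 2 * (4 : ℝ) ^ (-2 * ((n + 1 : ℕ) : ℤ)))
    (hfit : ∀ k ≤ 4, (4 : ℝ) ^ ((2 : ℤ) - (k : ℕ)) * cc k + eD k ≤ C k)
    (hfit' : ∀ k ≤ 4, (4 : ℝ) ^ ((2 : ℤ) - (k : ℕ)) * cc' k + eD' k ≤ C' k) (hfitO : 16 * x₀ + xD ≤ X) :
    TwoLegReadJetBound L M C C' β U μ K' (n + 1) ∧ TwoLegReadOscAt L M X β U μ K' (n + 1) := by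
  have hjets := twoLegReadJetBound_last_of_increment hIH hDdiff hD
  exact ⟨hjets.mono_le hfit hfit',
    (twoLegReadOscAt_last_of_increment hIH.1.continuous hjets.1.continuous hIHosc hDosc).mono hfitO⟩

/-- **«(P)-LAST», structured-value form**: the increment's mean-free clause replaced by `|Δ(θ) − τ| ≤ aΔ·U²·4^{−2(n+1)}` for SOME constant `τ`
(then `Δ` is within `2aΔ·U²·4^{−2(n+1)}` of its own mean); fit `16·x₀ + 2·aΔ ≤ X`. -/
theorem twoLegReadPriv_last_of_structured {β U μ : ℝ} {K K' : TrigPolyC4v} {n : ℕ} {cc cc' eD eD' C C' : ℕ → ℝ} {x₀ τ aD X : ℝ}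
    (hIH : TwoLegReadJetBound L M cc cc' β U μ K n) (hIHosc : TwoLegReadOscAt L M x₀ β U μ K n)
    (hDdiff : ContDiff ℝ 4 fun θ : ℝ => klLocalPart L M β U μ K' (n + 1) θ - klLocalPart L M β U μ K n θ)
    (hD : ∀ k ≤ 4, ∀ θ : ℝ, |iteratedDeriv k (fun θ : ℝ =>
      klLocalPart L M β U μ K' (n + 1) θ - klLocalPart L M β U μ K n θ) θ| ≤ curveJetBar eD eD' U k (n + 1))
    (hDval : ∀ θ : ℝ, |(klLocalPart L M β U μ K' (n + 1) θ - klLocalPart L M β U μ K n θ) - τ| ≤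
      aD * U ^ 2 * (4 : ℝ) ^ (-2 * ((n + 1 : ℕ) : ℤ)))
    (hfit : ∀ k ≤ 4, (4 : ℝ) ^ ((2 : ℤ) - (k : ℕ)) * cc k + eD k ≤ C k)
    (hfit' : ∀ k ≤ 4, (4 : ℝ) ^ ((2 : ℤ) - (k : ℕ)) * cc' k + eD' k ≤ C' k) (hfitO : 16 * x₀ + 2 * aD ≤ X) :
    TwoLegReadJetBound L M C C' β U μ K' (n + 1) ∧ TwoLegReadOscAt L M X β U μ K' (n + 1) := by
  have hID : IntervalIntegrable (fun θ : ℝ => klLocalPart L M β U μ K' (n + 1) θ - klLocalPart L M β U μ K n θ)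
      MeasureTheory.volume 0 (2 * π) := hDdiff.continuous.intervalIntegrable _ _
  refine twoLegReadPriv_last hIH hIHosc hDdiff hD (xD := 2 * aD) (fun θ => ?_) hfit hfit' hfitO
  have h := abs_sub_klAngularMean_le_two_mul_of_abs_sub_const_le hID hDval θ
  calc _ ≤ 2 * (aD * U ^ 2 * (4 : ℝ) ^ (-2 * ((n + 1 : ℕ) : ℤ))) := h
    _ = 2 * aD * U ^ 2 * (4 : ℝ) ^ (-2 * ((n + 1 : ℕ) : ℤ)) := by ring

/-! ## §3 The last step from a SPLIT increment `Δ = δ_{n+1}(K′) + S`, `S = ν_n(K′) − ν_n(K)` -/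

/-- `ν_{n+1}(K′) − ν_n(K) = δ_{n+1}(K′) + (ν_n(K′) − ν_n(K))` as functions of the angle. -/
theorem increment_eq_profile_add_frameShift (β U μ : ℝ) (K K' : TrigPolyC4v) (n : ℕ) :
    (fun θ : ℝ => klLocalPart L M β U μ K' (n + 1) θ - klLocalPart L M β U μ K n θ) =
      klTwoLegCurveProfile L M β U μ K' (n + 1) + fun θ : ℝ =>
        klLocalPart L M β U μ K' n θ - klLocalPart L M β U μ K n θ := by
  funext θ
  simp only [klTwoLegCurveProfile_succ, Pi.add_apply]
  ring

/-- **Jets of the split increment**: (A) `TwoLegCurveJetBound L M cA cA′ … K′ (n+1)` + jets of the frame shift `S` within `curveJetBar eS eS′ U k (n+1)`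
⟹ `Δ` is `C⁴` with jets within `curveJetBar (cA + eS) (cA′ + eS′) U k (n+1)`. -/
theorem increment_jets_of_split {β U μ : ℝ} {K K' : TrigPolyC4v} {n : ℕ} {cA cA' eS eS' : ℕ → ℝ}
    (hA : TwoLegCurveJetBound L M cA cA' β U μ K' (n + 1))
    (hSdiff : ContDiff ℝ 4 fun θ : ℝ => klLocalPart L M β U μ K' n θ - klLocalPart L M β U μ K n θ)
    (hS : ∀ k ≤ 4, ∀ θ : ℝ, |iteratedDeriv k (fun θ : ℝ =>
      klLocalPart L M β U μ K' n θ - klLocalPart L M β U μ K n θ) θ| ≤ curveJetBar eS eS' U k (n + 1)) :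
    ContDiff ℝ 4 (fun θ : ℝ => klLocalPart L M β U μ K' (n + 1) θ - klLocalPart L M β U μ K n θ) ∧
      ∀ k ≤ 4, ∀ θ : ℝ, |iteratedDeriv k (fun θ : ℝ =>
        klLocalPart L M β U μ K' (n + 1) θ - klLocalPart L M β U μ K n θ) θ| ≤
          curveJetBar (fun k => cA k + eS k) (fun k => cA' k + eS' k) U k (n + 1) := by
  have hsum := increment_eq_profile_add_frameShift (L := L) (M := M) β U μ K K' n
  refine ⟨?_, fun k hk θ => ?_⟩
  · rw [hsum]; exact hA.1.add hSdiff
  · rw [hsum, C4a.curveJetBar_add]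
    have hk' : (k : WithTop ℕ∞) ≤ 4 := by exact_mod_cast hk
    rw [iteratedDeriv_add (hA.1.contDiffAt.of_le hk') (hSdiff.contDiffAt.of_le hk')]
    exact (abs_add_le _ _).trans (add_le_add (hA.2 k hk θ) (hS k hk θ))

/-- **Structured value of the split increment**: `|δ_{n+1}(K′)(θ) − τ_A| ≤ a·U²·4^{−2(n+1)}` and `|S(θ) − τ_S| ≤ s·U²·4^{−2(n+1)}` ⟹
`|Δ(θ) − (τ_A + τ_S)| ≤ (a + s)·U²·4^{−2(n+1)}`. -/
theorem increment_structured_of_split {β U μ : ℝ} {K K' : TrigPolyC4v} {n : ℕ} {τA τS a s : ℝ}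
    (hAval : ∀ θ : ℝ, |klTwoLegCurveProfile L M β U μ K' (n + 1) θ - τA| ≤ a * U ^ 2 * (4 : ℝ) ^ (-2 * ((n + 1 : ℕ) : ℤ)))
    (hSval : ∀ θ : ℝ, |(klLocalPart L M β U μ K' n θ - klLocalPart L M β U μ K n θ) - τS| ≤
      s * U ^ 2 * (4 : ℝ) ^ (-2 * ((n + 1 : ℕ) : ℤ))) (θ : ℝ) :
    |(klLocalPart L M β U μ K' (n + 1) θ - klLocalPart L M β U μ K n θ) - (τA + τS)| ≤
      (a + s) * U ^ 2 * (4 : ℝ) ^ (-2 * ((n + 1 : ℕ) : ℤ)) := by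
  have h : klLocalPart L M β U μ K' (n + 1) θ - klLocalPart L M β U μ K n θ - (τA + τS) =
      (klTwoLegCurveProfile L M β U μ K' (n + 1) θ - τA) + ((klLocalPart L M β U μ K' n θ - klLocalPart L M β U μ K n θ) - τS) := by
    simp only [klTwoLegCurveProfile_succ]
    ring
  rw [h]
  calc _ ≤ a * U ^ 2 * (4 : ℝ) ^ (-2 * ((n + 1 : ℕ) : ℤ)) + s * U ^ 2 * (4 : ℝ) ^ (-2 * ((n + 1 : ℕ) : ℤ)) :=
        (abs_add_le _ _).trans (add_le_add (hAval θ) (hSval θ))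
    _ = (a + s) * U ^ 2 * (4 : ℝ) ^ (-2 * ((n + 1 : ℕ) : ℤ)) := by ring

/-- **«(P)-LAST», split form**: IH at `(K, n)` + (A) at `(K′, n+1)` (jets `(cA, cA′)` and structured value, budget `a`) + the frame shift `S = ν_n(K′) − ν_n(K)`
(`C⁴`, jets within `curveJetBar eS eS′ U k (n+1)`, structured value with budget `s`) + fits `4^{2−k}·cc k + (cA k + eS k) ≤ C k` (primed alike, `k ≤ 4`),
`16·x₀ + 2·(a + s) ≤ X` ⟹ both conjuncts at `(K′, n+1)`. -/
theorem twoLegReadPriv_last_of_split {β U μ : ℝ} {K K' : TrigPolyC4v} {n : ℕ} {cc cc' cA cA' eS eS' C C' : ℕ → ℝ}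
    {x₀ τA τS a s X : ℝ}
    (hIH : TwoLegReadJetBound L M cc cc' β U μ K n) (hIHosc : TwoLegReadOscAt L M x₀ β U μ K n)
    (hA : TwoLegCurveJetBound L M cA cA' β U μ K' (n + 1))
    (hAval : ∀ θ : ℝ, |klTwoLegCurveProfile L M β U μ K' (n + 1) θ - τA| ≤ a * U ^ 2 * (4 : ℝ) ^ (-2 * ((n + 1 : ℕ) : ℤ)))
    (hSdiff : ContDiff ℝ 4 fun θ : ℝ => klLocalPart L M β U μ K' n θ - klLocalPart L M β U μ K n θ)
    (hS : ∀ k ≤ 4, ∀ θ : ℝ, |iteratedDeriv k (fun θ : ℝ =>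
      klLocalPart L M β U μ K' n θ - klLocalPart L M β U μ K n θ) θ| ≤ curveJetBar eS eS' U k (n + 1))
    (hSval : ∀ θ : ℝ, |(klLocalPart L M β U μ K' n θ - klLocalPart L M β U μ K n θ) - τS| ≤
      s * U ^ 2 * (4 : ℝ) ^ (-2 * ((n + 1 : ℕ) : ℤ)))
    (hfit : ∀ k ≤ 4, (4 : ℝ) ^ ((2 : ℤ) - (k : ℕ)) * cc k + (cA k + eS k) ≤ C k)
    (hfit' : ∀ k ≤ 4, (4 : ℝ) ^ ((2 : ℤ) - (k : ℕ)) * cc' k + (cA' k + eS' k) ≤ C' k) (hfitO : 16 * x₀ + 2 * (a + s) ≤ X) :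
    TwoLegReadJetBound L M C C' β U μ K' (n + 1) ∧ TwoLegReadOscAt L M X β U μ K' (n + 1) := by
  obtain ⟨hDdiff, hD⟩ := increment_jets_of_split hA hSdiff hS
  exact twoLegReadPriv_last_of_structured hIH hIHosc hDdiff hD (increment_structured_of_split hAval hSval) hfit hfit' hfitO

/-! ## §4 The flow instance at the registered tables, numeric fits UNROLLED -/

/-- From five unrolled inequalities to the `k ≤ 4` fit with the index-shift factors `16, 4, 1, 1/4, 1/16`. -/
theorem fit_le4_of_unrolled {cc e C : ℕ → ℝ} (h0 : 16 * cc 0 + e 0 ≤ C 0) (h1 : 4 * cc 1 + e 1 ≤ C 1) (h2 : cc 2 + e 2 ≤ C 2)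
    (h3 : cc 3 / 4 + e 3 ≤ C 3) (h4 : cc 4 / 16 + e 4 ≤ C 4) :
    ∀ k ≤ 4, (4 : ℝ) ^ ((2 : ℤ) - (k : ℕ)) * cc k + e k ≤ C k := by
  obtain ⟨e0, e1, e2, e3, e4⟩ := four_zpow_two_sub_values
  intro k hk
  interval_cases k
  · rw [e0]; exact h0
  · rw [e1]; exact h1
  · rw [e2, one_mul]; exact h2
  · rw [e3]; simpa [div_eq_inv_mul, mul_comm] using h3
  · rw [e4]; simpa [div_eq_inv_mul, mul_comm] using h4

/-- **«(P)-LAST» AT THE FLOW FRAMES AND THE REGISTERED TABLES** (the closer's call at the last index `n + 1 = n_β + 1`): the private conjuncts at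
`(K_n, n)`, the total increment `Δ = ν_{n+1}(K_{n+1}) − ν_n(K_n)` (`C⁴`, jets within `curveJetBar eΔ eΔ′ U k (n+1)`, mean-free value within
`xΔ·U²·4^{−2(n+1)}`) and the unrolled fits against `klC4aJetC2 = (2¹⁰, 2¹⁰, 2⁴, 2⁴, 2¹¹)`, `klC4aJetC′ P R` and `klReadOscC P R` ⟹ the REGISTERED conclusion
of stub (C) v2 at `(K_{n+1}, n+1)`. -/
theorem twoLegRead_flow_last_registered {P : SplitConsts} {R : RenConsts} {β U μ : ℝ} {n : ℕ} {cc cc' eD eD' : ℕ → ℝ} {x₀ xD : ℝ}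
    (hIH : TwoLegReadJetBound L M cc cc' β U μ (klFlowFrameU L M β U μ n) n ∧
      TwoLegReadOscAt L M x₀ β U μ (klFlowFrameU L M β U μ n) n)
    (hDdiff : ContDiff ℝ 4 fun θ : ℝ => klLocalPart L M β U μ (klFlowFrameU L M β U μ (n + 1)) (n + 1) θ -
      klLocalPart L M β U μ (klFlowFrameU L M β U μ n) n θ)
    (hD : ∀ k ≤ 4, ∀ θ : ℝ, |iteratedDeriv k (fun θ : ℝ =>
      klLocalPart L M β U μ (klFlowFrameU L M β U μ (n + 1)) (n + 1) θ - klLocalPart L M β U μ (klFlowFrameU L M β U μ n) n θ) θ| ≤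
        curveJetBar eD eD' U k (n + 1))
    (hDosc : ∀ θ : ℝ, |(klLocalPart L M β U μ (klFlowFrameU L M β U μ (n + 1)) (n + 1) θ -
          klLocalPart L M β U μ (klFlowFrameU L M β U μ n) n θ) -
        klAngularMean (fun θ : ℝ => klLocalPart L M β U μ (klFlowFrameU L M β U μ (n + 1)) (n + 1) θ -
          klLocalPart L M β U μ (klFlowFrameU L M β U μ n) n θ)| ≤ xD * U ^ 2 * (4 : ℝ) ^ (-2 * ((n + 1 : ℕ) : ℤ)))
    (h0 : 16 * cc 0 + eD 0 ≤ 2 ^ 10) (h1 : 4 * cc 1 + eD 1 ≤ 2 ^ 10) (h2 : cc 2 + eD 2 ≤ 2 ^ 4) (h3 : cc 3 / 4 + eD 3 ≤ 2 ^ 4)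
    (h4 : cc 4 / 16 + eD 4 ≤ 2 ^ 11)
    (h0' : 16 * cc' 0 + eD' 0 ≤ klC4aJetC' P R 0) (h1' : 4 * cc' 1 + eD' 1 ≤ klC4aJetC' P R 1) (h2' : cc' 2 + eD' 2 ≤ klC4aJetC' P R 2)
    (h3' : cc' 3 / 4 + eD' 3 ≤ klC4aJetC' P R 3) (h4' : cc' 4 / 16 + eD' 4 ≤ klC4aJetC' P R 4)
    (hO : 16 * x₀ + xD ≤ klReadOscC P R) :
    TwoLegReadJetBound L M klC4aJetC2 (klC4aJetC' P R) β U μ (klFlowFrameU L M β U μ (n + 1)) (n + 1) ∧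
      TwoLegReadOscAt L M (klReadOscC P R) β U μ (klFlowFrameU L M β U μ (n + 1)) (n + 1) := by
  refine twoLegReadPriv_last hIH.1 hIH.2 hDdiff hD hDosc (fit_le4_of_unrolled ?_ ?_ ?_ ?_ ?_) (fit_le4_of_unrolled h0' h1' h2' h3' h4') hO
  · simpa using h0
  · simpa using h1
  · simpa using h2
  · simpa using h3
  · simpa using h4


/-! ## §5 (appended) «(P)-STEP» from the WHOLE residue `(P) = ν_n(K′)|_{γ_{K′}}` in one bracket -/

/-- **The step at ANY frame `K′` from (A) + the residue (P) delivered WHOLE** (one bracket instead of (B)+(C2)+(C1); e.g. a re-derived last-step door of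
(R111)(3) type (γ)): (A) jets `(cA, cA′)` and structured value (budget `a`) at `(K′, n+1)`, the residue `θ ↦ ν_n(K′)(θ)` `C⁴` with jets within
`curveJetBar e e′ U k (n+1)` and ZERO un-primed value entry `e 0 = 0` (pure `U²` currency at `k = 0`), fits `cA + e ≤ cc`, `cA′ + e′ ≤ cc′`, `a + e′ 0 ≤ x₀/2`
⟹ both private conjuncts at `(K′, n+1)`.  No hypothesis at `(K, n)` is read: the residue bound carries it. -/
theorem twoLegReadPriv_succ_of_hP {β U μ : ℝ} {K' : TrigPolyC4v} {n : ℕ} {cA cA' e e' cc cc' : ℕ → ℝ} {τA a x₀ : ℝ}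
    (hA : TwoLegCurveJetBound L M cA cA' β U μ K' (n + 1))
    (hAval : ∀ θ : ℝ, |klTwoLegCurveProfile L M β U μ K' (n + 1) θ - τA| ≤ a * U ^ 2 * (4 : ℝ) ^ (-2 * ((n + 1 : ℕ) : ℤ)))
    (hPdiff : ContDiff ℝ 4 fun θ : ℝ => klLocalPart L M β U μ K' n θ)
    (hP : ∀ k ≤ 4, ∀ θ : ℝ, |iteratedDeriv k (fun θ : ℝ => klLocalPart L M β U μ K' n θ) θ| ≤ curveJetBar e e' U k (n + 1))
    (he0 : e 0 = 0) (hfit : ∀ k, cA k + e k ≤ cc k) (hfit' : ∀ k, cA' k + e' k ≤ cc' k) (hfitO : a + e' 0 ≤ x₀ / 2) :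
    TwoLegReadJetBound L M cc cc' β U μ K' (n + 1) ∧ TwoLegReadOscAt L M x₀ β U μ K' (n + 1) := by
  have hjets : TwoLegReadJetBound L M cc cc' β U μ K' (n + 1) :=
    TwoLegReadJetBound.mono hfit hfit' (C4a.twoLegReadJetBound_succ_of_curveJetBound_of_prev hA hPdiff hP)
  refine ⟨hjets, twoLegReadOscAt_succ_of_structured hjets.1.continuous hAval (τP := 0) (fun θ => ?_) hfitO⟩
  rw [sub_zero]
  have h := hP 0 (Nat.zero_le _) θ
  rw [iteratedDeriv_zero] at h
  exact abs_le_of_curveJetBar_zero_of_fst_eq_zero he0 h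

/-- **The flow instance** `K′ := klFlowFrameU L M β U μ (n+1)` of `twoLegReadPriv_succ_of_hP` (the residue = `readResidue_flow_hP`'s own output, or any
one-bracket replacement of it). -/
theorem twoLegReadPriv_flow_succ_of_hP (β U μ : ℝ) {n : ℕ} {cA cA' e e' cc cc' : ℕ → ℝ} {τA a x₀ : ℝ}
    (hA : TwoLegCurveJetBound L M cA cA' β U μ (klFlowFrameU L M β U μ (n + 1)) (n + 1))
    (hAval : ∀ θ : ℝ, |klTwoLegCurveProfile L M β U μ (klFlowFrameU L M β U μ (n + 1)) (n + 1) θ - τA| ≤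
      a * U ^ 2 * (4 : ℝ) ^ (-2 * ((n + 1 : ℕ) : ℤ)))
    (hPdiff : ContDiff ℝ 4 fun θ : ℝ => klLocalPart L M β U μ (klFlowFrameU L M β U μ (n + 1)) n θ)
    (hP : ∀ k ≤ 4, ∀ θ : ℝ, |iteratedDeriv k (fun θ : ℝ => klLocalPart L M β U μ (klFlowFrameU L M β U μ (n + 1)) n θ) θ| ≤
      curveJetBar e e' U k (n + 1))
    (he0 : e 0 = 0) (hfit : ∀ k, cA k + e k ≤ cc k) (hfit' : ∀ k, cA' k + e' k ≤ cc' k) (hfitO : a + e' 0 ≤ x₀ / 2) :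
    TwoLegReadJetBound L M cc cc' β U μ (klFlowFrameU L M β U μ (n + 1)) (n + 1) ∧
      TwoLegReadOscAt L M x₀ β U μ (klFlowFrameU L M β U μ (n + 1)) (n + 1) :=
  twoLegReadPriv_succ_of_hP hA hAval hPdiff hP he0 hfit hfit' hfitO


/-! ## §6 (appended) «(P)-DRIVER» — the closer's induction over the scales as ONE lemma in private/registered currency -/
/-- **«(P)-DRIVER».**  Private tables below the registered ones; the private pair at `(K₀, 0)` (`twoLegReadPriv_zero`); the private STEP
`(K_m, m) → (K_{m+1}, m+1)` for `m + 1 ≤ N` (`twoLegReadPriv_flow_succ[_of_hP]` fed by the scale-`m` doors); the LAST step `(K_N, N) → (K_{N+1}, N+1)`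
concluding the REGISTERED pair (`twoLegRead_flow_last_registered`, or a private step + `twoLegRead_registered_of_priv`) ⟹ stub (C) v2's registered pair at
EVERY `n ≤ N + 1` (`N := nScales β`).  Pure bookkeeping (induction on `n`). -/
theorem twoLegRead_registered_all {P : SplitConsts} {R : RenConsts} {β U μ : ℝ} {cc cc' : ℕ → ℝ} {x₀ : ℝ} {N : ℕ}
    (hcc : ∀ k, cc k ≤ klC4aJetC2 k) (hcc' : ∀ k, cc' k ≤ klC4aJetC' P R k) (hx₀ : x₀ ≤ klReadOscC P R)
    (h0 : TwoLegReadJetBound L M cc cc' β U μ (klFlowFrameU L M β U μ 0) 0 ∧ TwoLegReadOscAt L M x₀ β U μ (klFlowFrameU L M β U μ 0) 0)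
    (hstep : ∀ m, m + 1 ≤ N →
      (TwoLegReadJetBound L M cc cc' β U μ (klFlowFrameU L M β U μ m) m ∧ TwoLegReadOscAt L M x₀ β U μ (klFlowFrameU L M β U μ m) m) →
      (TwoLegReadJetBound L M cc cc' β U μ (klFlowFrameU L M β U μ (m + 1)) (m + 1) ∧
        TwoLegReadOscAt L M x₀ β U μ (klFlowFrameU L M β U μ (m + 1)) (m + 1)))
    (hlast : (TwoLegReadJetBound L M cc cc' β U μ (klFlowFrameU L M β U μ N) N ∧ TwoLegReadOscAt L M x₀ β U μ (klFlowFrameU L M β U μ N) N) →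
      (TwoLegReadJetBound L M klC4aJetC2 (klC4aJetC' P R) β U μ (klFlowFrameU L M β U μ (N + 1)) (N + 1) ∧
        TwoLegReadOscAt L M (klReadOscC P R) β U μ (klFlowFrameU L M β U μ (N + 1)) (N + 1))) :
    ∀ n ≤ N + 1, TwoLegReadJetBound L M klC4aJetC2 (klC4aJetC' P R) β U μ (klFlowFrameU L M β U μ n) n ∧
      TwoLegReadOscAt L M (klReadOscC P R) β U μ (klFlowFrameU L M β U μ n) n := by
  have hpriv : ∀ n ≤ N, TwoLegReadJetBound L M cc cc' β U μ (klFlowFrameU L M β U μ n) n ∧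
      TwoLegReadOscAt L M x₀ β U μ (klFlowFrameU L M β U μ n) n := by
    intro n; induction n with
    | zero => exact fun _ => h0
    | succ m ih => exact fun hm => hstep m hm (ih (Nat.le_of_succ_le hm))
  intro n hn
  rcases Nat.lt_or_ge n (N + 1) with hlt | hge
  · exact twoLegRead_registered_of_priv hcc hcc' hx₀ (hpriv n (Nat.lt_succ_iff.mp hlt))
  · obtain rfl : n = N + 1 := le_antisymm hn hge
    exact hlast (hpriv N le_rfl)

/-- **«(P)-DRIVER», uniform form**: the last step also PRIVATE ((A)+(P) at every index): `h0` + `hstep` for `m + 1 ≤ N + 1` ⟹ registered at all `n ≤ N+1`. -/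
theorem twoLegRead_registered_all_uniform {P : SplitConsts} {R : RenConsts} {β U μ : ℝ} {cc cc' : ℕ → ℝ} {x₀ : ℝ} {N : ℕ}
    (hcc : ∀ k, cc k ≤ klC4aJetC2 k) (hcc' : ∀ k, cc' k ≤ klC4aJetC' P R k) (hx₀ : x₀ ≤ klReadOscC P R)
    (h0 : TwoLegReadJetBound L M cc cc' β U μ (klFlowFrameU L M β U μ 0) 0 ∧ TwoLegReadOscAt L M x₀ β U μ (klFlowFrameU L M β U μ 0) 0)
    (hstep : ∀ m, m + 1 ≤ N + 1 →
      (TwoLegReadJetBound L M cc cc' β U μ (klFlowFrameU L M β U μ m) m ∧ TwoLegReadOscAt L M x₀ β U μ (klFlowFrameU L M β U μ m) m) →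
      (TwoLegReadJetBound L M cc cc' β U μ (klFlowFrameU L M β U μ (m + 1)) (m + 1) ∧
        TwoLegReadOscAt L M x₀ β U μ (klFlowFrameU L M β U μ (m + 1)) (m + 1))) :
    ∀ n ≤ N + 1, TwoLegReadJetBound L M klC4aJetC2 (klC4aJetC' P R) β U μ (klFlowFrameU L M β U μ n) n ∧
      TwoLegReadOscAt L M (klReadOscC P R) β U μ (klFlowFrameU L M β U μ n) n :=
  twoLegRead_registered_all hcc hcc' hx₀ h0 (fun m hm => hstep m (Nat.le_succ_of_le hm))
    fun h => twoLegRead_registered_of_priv hcc hcc' hx₀ (hstep N le_rfl h)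

end Model

end Summit.HubbardSuperconductivity.HubbardSuperconductivity.Theorems.KLRegimeSplit

end
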